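import Summits.AtomisticToContinuum.FouriersLaw.Theses.OddSectorIrreversibility
import Summits.AtomisticToContinuum.FouriersLaw.Theorems.OddResponseBound.Negative.OddPairing
import Literature.MathematicalPhysics.KineticTheory.LangevinChainGibbs

/-!
# ConeScaleCorrector — Green–Kubo floor, the harmonic exponent `3`, the degenerate slice, and the shape of a kill (negative-side support)

Support lemmas for crux `OddSectorIrreversibility.ConeScaleCorrector` (item stmt-AtomisticToContinuum-14069,
"E1": `∫ u_N² dμ_T ≤ C N² Z` for every a.e.-limit `u_N` of the finite-horizon Kubo correctors of the OPEN
chain) extracted from the standing disprover's work file `Cruxes/ConeScaleCorrector/Disproof.lean`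
(§1–§4 there); all sorry-free, NO definitions (hypotheses are inlined), nothing closes an item and no
conclusion asserts a Theses decl positively.

* `corrector_normSq_gk_floor`, `corrector_normSq_ge_of_greenKubo` — the GREEN–KUBO FLOOR: if
  `∫ u J = (N−1) T² D Z` (route item CorrectorTheory, conjunct B, unnormalised) and `∫ J² ≤ K N Z` then
  `∫ u² ≥ (N−1)² T⁴ D² Z/(K N)`; under Fourier's law (`D = D_N → κ > 0`) the exponent of E1 cannot be
  lowered below `1`, and E1's `2` is exactly one power of `N` (the deterministic causal window) above it.
* `harmonic_corrector_exceeds` — UNCONDITIONAL core of "anharmonicity is load-bearing": with the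
  harmonic (RLL) Green–Kubo value `∫ u J = (N−1) T² ((N−1) c_N) Z` (`c_N = fluxCoeff ω₂ γ N`, every bond
  of the RLL chain carries `c_N ΔT`, tree: `integral_bondCurrent_harmonicNESS_eq_fluxCoeff`) and
  `∫ J² ≤ K N Z`, EVERY such `u` has `∫ u² > C N² Z` for large `N`, for any prescribed `C` — because
  `c_N → c_∞ > 0` (`tendsto_fluxCoeff`, `fluxLimit_pos`, PROVED): the harmonic member of E1 fails with
  exponent `3` as soon as its corrector exists and satisfies Green–Kubo (numerically `‖u‖² ≈ 0.3 N³`).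
* `coneScaleCorrector_slice_le_one` — the degenerate slice `N ≤ 1` of the crux holds for every `C ≥ 0`
  (`J_tot ≡ 0` forces `u = 0` a.e.): no refutation at `N = 0, 1`.
* `coneScaleCorrector_false_of_cubicFloor` — KILL SHAPE (criterion (a′) of the route): existence of the
  correctors plus an equilibrium floor `c N³ Z ≤ ∫ u² dμ_T` from some `N₀` on, at ONE admissible
  parameter point, refutes the crux. (The replica numerics of the disprover measure
  `‖u_τ‖²_π ≤ 4‖u‖²_π` directly; results on the item.)
-/

noncomputable section

namespace Summit.AtomisticToContinuum.FouriersLaw.Theorems.ConeScaleCorrector.Negative.Floors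

open MeasureTheory Filter Topology Set
open Literature.MathematicalPhysics.KineticTheory.HeatConduction
open Summit.AtomisticToContinuum.FouriersLaw.Theses.OddSectorIrreversibility
open Summit.AtomisticToContinuum.FouriersLaw.Theorems.OddResponseBound.Negative.OddPairing

/-! ## §1 the Green–Kubo floor -/

/-- **Green–Kubo floor** (abstract Cauchy–Schwarz): if `∫ u J = A` and `∫ J² ≤ V` with `0 < V` then
`A²/V ≤ ∫ u²`. [folklore] -/
theorem corrector_normSq_gk_floor {X : Type*} [MeasurableSpace X] {μ : Measure X} {u J : X → ℝ}
    (hu : MemLp u 2 μ) (hJ : MemLp J 2 μ) {A V : ℝ} (hA : ∫ x, u x * J x ∂μ = A) (hV : 0 < V)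
    (hJV : ∫ x, J x ^ 2 ∂μ ≤ V) : A ^ 2 / V ≤ ∫ x, u x ^ 2 ∂μ := by
  have hCS := sq_integral_mul_le hu hJ
  rw [hA] at hCS
  have h0 : 0 ≤ ∫ x, u x ^ 2 ∂μ := integral_nonneg fun _ => sq_nonneg _
  rw [div_le_iff₀ hV]
  calc A ^ 2 ≤ (∫ x, u x ^ 2 ∂μ) * ∫ x, J x ^ 2 ∂μ := hCS
    _ ≤ (∫ x, u x ^ 2 ∂μ) * V := mul_le_mul_of_nonneg_left hJV h0

/-- The floor in crux units: `∫ u J dμ_T = (N−1) T² D Z` and `∫ J² dμ_T ≤ K N Z` with `0 < K, N, Z`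
give `(N−1)² T⁴ D²/(K N) · Z ≤ ∫ u² dμ_T`. With `D = D_N → κ(T) > 0` (Fourier) the right order is
`≥ N·Z`; for the harmonic chain `D_N = (N−1) c_N ≍ N` and the same floor is `≍ N³ Z`. [folklore] -/
theorem corrector_normSq_ge_of_greenKubo {N : ℕ} {μ : Measure (PhaseSpace N)} {u J : PhaseSpace N → ℝ}
    (hu : MemLp u 2 μ) (hJ : MemLp J 2 μ) {T D K Z : ℝ} (hK : 0 < K) (hN : 0 < N) (hZ : 0 < Z)
    (hGK : ∫ x, u x * J x ∂μ = ((N : ℝ) - 1) * T ^ 2 * D * Z) (hJV : ∫ x, J x ^ 2 ∂μ ≤ K * N * Z) :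
    ((N : ℝ) - 1) ^ 2 * T ^ 4 * D ^ 2 / (K * N) * Z ≤ ∫ x, u x ^ 2 ∂μ := by
  have hN' : (0 : ℝ) < N := by exact_mod_cast hN
  have h := corrector_normSq_gk_floor hu hJ hGK (by positivity) hJV
  have e : (((N : ℝ) - 1) * T ^ 2 * D * Z) ^ 2 / (K * N * Z) =
      ((N : ℝ) - 1) ^ 2 * T ^ 4 * D ^ 2 / (K * N) * Z := by
    field_simp
  rw [← e]; exact h

/-! ## §2 the harmonic member fails with exponent `3` (unconditional core) -/

/-- **Harmonic Green–Kubo pairing forces `∫ u² ≫ N² Z`.** For the RLL flux coefficients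
`c_N = fluxCoeff ω₂ γ N` and ANY constants `C, K`: for all large `N`, on ANY measure space, every
`u, J ∈ L²` with `∫ u J = (N−1) T² ((N−1) c_N) Z`, `∫ J² ≤ K N Z`, `Z > 0`, `T² ≥ 1` satisfy
`C N² Z < ∫ u²`. Specialised to `μ = e^{−H/T}dqdp` of `pinnedChain ω₂ 0 0 γ`, `J = J_tot`, `T = 1`,
this says: the `lam = β = 0` member of E1 fails (with exponent `3`) as soon as its Kubo corrector
exists and obeys the open-chain Green–Kubo identity `⟨u, J_tot⟩_π = (N−1)T²D_N`, `D_N = (N−1)c_N` —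
anharmonicity is load-bearing. Mechanism: Cauchy–Schwarz and `c_N → c_∞ > 0` (ballistic flux,
`tendsto_fluxCoeff`, `fluxLimit_pos`): `∫ u² ≥ (N−1)⁴ c_N² Z/(K N)`. [folklore] -/
theorem harmonic_corrector_exceeds {ω₂ γ : ℝ} (hω : 0 < ω₂) (hγ : 0 < γ) (C K : ℝ) :
    ∃ N₀ : ℕ, ∀ N : ℕ, N₀ ≤ N → ∀ {X : Type} [MeasurableSpace X] (μ : Measure X) (u J : X → ℝ)
      (T Z : ℝ), 1 ≤ T ^ 2 → 0 < Z → MemLp u 2 μ → MemLp J 2 μ →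
      ∫ x, u x * J x ∂μ = ((N : ℝ) - 1) * T ^ 2 * (((N : ℝ) - 1) * fluxCoeff ω₂ γ N) * Z →
      ∫ x, J x ^ 2 ∂μ ≤ K * (N : ℝ) * Z →
      C * (N : ℝ) ^ 2 * Z < ∫ x, u x ^ 2 ∂μ := by
  set c := fluxLimit ω₂ γ with hc_def
  have hc : 0 < c := fluxLimit_pos hω hγ
  set C' := max C 1 with hC'_def
  set K' := max K 1 with hK'_def
  have hC'pos : 0 < C' := lt_of_lt_of_le one_pos (le_max_right C 1)
  have hK'pos : 0 < K' := lt_of_lt_of_le one_pos (le_max_right K 1)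
  have hev1 : ∀ᶠ N : ℕ in atTop, c / 2 < fluxCoeff ω₂ γ N :=
    (tendsto_fluxCoeff hω hγ).eventually_const_lt (by linarith)
  have hev2 : ∀ᶠ N : ℕ in atTop, 2 ≤ N := eventually_ge_atTop 2
  have hev3 : ∀ᶠ N : ℕ in atTop, 64 * C' * K' / c ^ 2 < (N : ℝ) :=
    (tendsto_natCast_atTop_atTop (R := ℝ)).eventually_gt_atTop _
  obtain ⟨N₀, hN₀⟩ := (hev1.and (hev2.and hev3)).exists_forall_of_atTop
  refine ⟨N₀, fun N hN X _ μ u J T Z hT hZ huL2 hJL2 hGK hK => ?_⟩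
  obtain ⟨hN1, hN2, hN3⟩ := hN₀ N hN
  set f := fluxCoeff ω₂ γ N with hf_def
  have hN0 : (0 : ℝ) ≤ N := Nat.cast_nonneg N
  have hN2r : (2 : ℝ) ≤ N := by exact_mod_cast hN2
  by_contra hnot
  have hbound : ∫ x, u x ^ 2 ∂μ ≤ C * (N : ℝ) ^ 2 * Z := le_of_not_gt hnot
  have hCS := sq_integral_mul_le huL2 hJL2
  rw [hGK] at hCS
  have hu2 : ∫ x, u x ^ 2 ∂μ ≤ C' * (N : ℝ) ^ 2 * Z :=
    hbound.trans (mul_le_mul_of_nonneg_right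
      (mul_le_mul_of_nonneg_right (le_max_left C 1) (by positivity)) hZ.le)
  have hJK : ∫ x, J x ^ 2 ∂μ ≤ K' * (N : ℝ) * Z :=
    hK.trans (mul_le_mul_of_nonneg_right (mul_le_mul_of_nonneg_right (le_max_left K 1) hN0) hZ.le)
  have hprod : (∫ x, u x ^ 2 ∂μ) * ∫ x, J x ^ 2 ∂μ ≤ (C' * (N : ℝ) ^ 2 * Z) * (K' * (N : ℝ) * Z) :=
    mul_le_mul hu2 hJK (integral_nonneg fun _ => sq_nonneg _) (by positivity)
  have e1 : (((N : ℝ) - 1) * T ^ 2 * (((N : ℝ) - 1) * f) * Z) ^ 2 =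
      ((N : ℝ) - 1) ^ 4 * f ^ 2 * (T ^ 2) ^ 2 * Z ^ 2 := by ring
  have e2 : (C' * (N : ℝ) ^ 2 * Z) * (K' * (N : ℝ) * Z) = C' * K' * (N : ℝ) ^ 3 * Z ^ 2 := by ring
  have key : ((N : ℝ) - 1) ^ 4 * f ^ 2 * (T ^ 2) ^ 2 * Z ^ 2 ≤ C' * K' * (N : ℝ) ^ 3 * Z ^ 2 := by
    rw [← e1, ← e2]; exact hCS.trans hprod
  have key' : ((N : ℝ) - 1) ^ 4 * f ^ 2 * (T ^ 2) ^ 2 ≤ C' * K' * (N : ℝ) ^ 3 :=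
    le_of_mul_le_mul_right key (pow_pos hZ 2)
  -- `(T²)² ≥ 1`, `f > c/2`, `N - 1 ≥ N/2`
  have hT4 : (1 : ℝ) ≤ (T ^ 2) ^ 2 := by nlinarith
  have hbase : 0 ≤ ((N : ℝ) - 1) ^ 4 * f ^ 2 := by positivity
  have key'' : ((N : ℝ) - 1) ^ 4 * f ^ 2 ≤ C' * K' * (N : ℝ) ^ 3 := by
    have : ((N : ℝ) - 1) ^ 4 * f ^ 2 * 1 ≤ ((N : ℝ) - 1) ^ 4 * f ^ 2 * (T ^ 2) ^ 2 :=
      mul_le_mul_of_nonneg_left hT4 hbase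
    linarith
  have hf : c / 2 < f := hN1
  have hf2 : c ^ 2 / 4 ≤ f ^ 2 := by nlinarith
  have hN14 : ((N : ℝ) / 2) ^ 4 ≤ ((N : ℝ) - 1) ^ 4 :=
    pow_le_pow_left₀ (by positivity) (by linarith) 4
  have h3 : ((N : ℝ) / 2) ^ 4 * (c ^ 2 / 4) ≤ C' * K' * (N : ℝ) ^ 3 :=
    (mul_le_mul hN14 hf2 (by positivity) (by positivity)).trans key''
  have h4 : ((N : ℝ) / 2) ^ 4 * (c ^ 2 / 4) = (N : ℝ) ^ 3 * ((N : ℝ) * c ^ 2 / 64) := by ring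
  have h5 : C' * K' * (N : ℝ) ^ 3 = (N : ℝ) ^ 3 * (C' * K') := by ring
  rw [h4, h5] at h3
  have hN3pos : (0 : ℝ) < (N : ℝ) ^ 3 := by positivity
  have h6 : (N : ℝ) * c ^ 2 / 64 ≤ C' * K' := le_of_mul_le_mul_left h3 hN3pos
  have h7 : 64 * C' * K' < (N : ℝ) * c ^ 2 := by
    have := hN3
    rw [div_lt_iff₀ (by positivity)] at this
    linarith
  linarith

/-! ## §3 the degenerate slice `N ≤ 1` holds -/

/-- For `N ≤ 1` there is no bond: `J_tot ≡ 0`. [folklore] -/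
theorem sum_bondCurrent_eq_zero_of_le_one (P : OscillatorChain) {N : ℕ} (hN : N ≤ 1)
    (z : PhaseSpace N) : ∑ i : Fin N, P.bondCurrent N i z = 0 := by
  unfold OscillatorChain.bondCurrent
  refine Finset.sum_eq_zero fun i _ => Finset.sum_eq_zero fun j _ => ?_
  have hi := i.isLt
  have hj := j.isLt
  rw [if_neg (by omega)]

/-- **Degenerate slice.** For ANY chain, measure, temperatures and `N ≤ 1`: the corrector predicate of
the crux forces `u = 0` a.e. (the integrand vanishes), so `u ∈ L²` and `∫ u² ≤ C N^k Z` for every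
`C, Z ≥ 0`. The `N = 0, 1` instances of `ConeScaleCorrector` are true for every `C ≥ 0`. [folklore] -/
theorem coneScaleCorrector_slice_le_one (P : OscillatorChain) {N : ℕ} (hN : N ≤ 1) (T_L T_R : ℝ)
    (μ : Measure (PhaseSpace N)) {C Z : ℝ} (hC : 0 ≤ C) (hZ : 0 ≤ Z) (k : ℕ) (u : PhaseSpace N → ℝ)
    (hu : ∀ᵐ x ∂μ, Tendsto (fun τ : ℝ => ∫ t in Set.Ioc (0 : ℝ) τ,
      (∫ y, (∑ i : Fin N, P.bondCurrent N i y) ∂(P.transitionKernel N T_L T_R t.toNNReal x)))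
      atTop (𝓝 (u x))) :
    MemLp u 2 μ ∧ ∫ x, (u x) ^ 2 ∂μ ≤ C * (N : ℝ) ^ k * Z := by
  have hu0 : u =ᵐ[μ] 0 := by
    filter_upwards [hu] with x hx
    have h0 : (fun τ : ℝ => ∫ t in Set.Ioc (0 : ℝ) τ,
        (∫ y, (∑ i : Fin N, P.bondCurrent N i y) ∂(P.transitionKernel N T_L T_R t.toNNReal x))) =
        fun _ => 0 := by
      funext τ
      simp [sum_bondCurrent_eq_zero_of_le_one P hN]
    rw [h0] at hx
    exact tendsto_nhds_unique hx tendsto_const_nhds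
  have hz : MemLp (0 : PhaseSpace N → ℝ) 2 μ := MemLp.zero
  refine ⟨hz.ae_eq hu0.symm, ?_⟩
  have h1 : ∫ x, (u x) ^ 2 ∂μ = 0 := by
    have : (fun x => (u x) ^ 2) =ᵐ[μ] fun _ => (0 : ℝ) := by
      filter_upwards [hu0] with x hx
      simp [hx]
    rw [integral_congr_ae this, integral_zero]
  rw [h1]
  positivity

/-! ## §4 the shape of a kill: an equilibrium `N³` floor at one admissible point refutes the crux -/

/-- **Kill shape (criterion (a′) of the route).** If at one admissible parameter point, from some `N₀`
on, (i) the Kubo corrector exists (some `u` is an a.e. limit of the finite-horizon correctors) and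
(ii) every such `u` has `c N³ Z ≤ ∫ u² dμ_T` for a fixed `c > 0`, then `ConeScaleCorrector` is false:
`c N³ ≤ C N²` fails for `N > C/c`. (`μ_T`, `Z`, the corrector predicate verbatim as in the crux.)
[folklore] -/
theorem coneScaleCorrector_false_of_cubicFloor {ω₂ lam β γ T c : ℝ} (hω : 0 < ω₂) (hl : 0 < lam)
    (hβ : 0 < β) (hγ : 0 < γ) (hT : 0 < T) (hc : 0 < c) (N₀ : ℕ)
    (hex : ∀ N : ℕ, N₀ ≤ N → ∃ u : PhaseSpace N → ℝ,
      ∀ᵐ x ∂(volume.withDensity fun x : PhaseSpace N =>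
          ENNReal.ofReal (Real.exp (-((pinnedChain ω₂ lam β γ).hamiltonian N x) / T))),
        Tendsto (fun τ : ℝ => ∫ t in Set.Ioc (0 : ℝ) τ,
          (∫ y, (∑ i : Fin N, (pinnedChain ω₂ lam β γ).bondCurrent N i y)
            ∂((pinnedChain ω₂ lam β γ).transitionKernel N T T t.toNNReal x))) atTop (𝓝 (u x)))
    (hfloor : ∀ N : ℕ, N₀ ≤ N → ∀ u : PhaseSpace N → ℝ,
      (∀ᵐ x ∂(volume.withDensity fun x : PhaseSpace N =>
          ENNReal.ofReal (Real.exp (-((pinnedChain ω₂ lam β γ).hamiltonian N x) / T))),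
        Tendsto (fun τ : ℝ => ∫ t in Set.Ioc (0 : ℝ) τ,
          (∫ y, (∑ i : Fin N, (pinnedChain ω₂ lam β γ).bondCurrent N i y)
            ∂((pinnedChain ω₂ lam β γ).transitionKernel N T T t.toNNReal x))) atTop (𝓝 (u x))) →
      c * (N : ℝ) ^ 3 * ∫ x, Real.exp (-((pinnedChain ω₂ lam β γ).hamiltonian N x) / T) ≤
        ∫ x, (u x) ^ 2 ∂(volume.withDensity fun x : PhaseSpace N =>
          ENNReal.ofReal (Real.exp (-((pinnedChain ω₂ lam β γ).hamiltonian N x) / T)))) :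
    ¬ ConeScaleCorrector := by
  intro hE
  obtain ⟨C, hC⟩ := hE ω₂ lam β γ hω hl hβ hγ T hT
  set C' := max C 1 with hC'_def
  have hC'pos : 0 < C' := lt_of_lt_of_le one_pos (le_max_right C 1)
  have hev1 : ∀ᶠ N : ℕ in atTop, N₀ ≤ N := eventually_ge_atTop N₀
  have hev2 : ∀ᶠ N : ℕ in atTop, 1 ≤ N := eventually_ge_atTop 1
  have hev3 : ∀ᶠ N : ℕ in atTop, C' / c < (N : ℝ) :=
    (tendsto_natCast_atTop_atTop (R := ℝ)).eventually_gt_atTop _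
  obtain ⟨N, hN1, hN2, hN3⟩ := (hev1.and (hev2.and hev3)).exists
  obtain ⟨u, hu⟩ := hex N hN1
  obtain ⟨_, hbound⟩ := hC N u hu
  have hfl := hfloor N hN1 u hu
  set Z := ∫ x, Real.exp (-((pinnedChain ω₂ lam β γ).hamiltonian N x) / T) with hZ_def
  have hZ : 0 < Z := integral_exp_pos (pinnedChain_integrable_gibbsDensity hω hl.le hβ.le γ N hT)
  have hN1r : (1 : ℝ) ≤ N := by exact_mod_cast hN2
  have hN2pos : (0 : ℝ) < (N : ℝ) ^ 2 := by positivity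
  have h1 : c * (N : ℝ) ^ 3 * Z ≤ C' * (N : ℝ) ^ 2 * Z :=
    (hfl.trans hbound).trans (mul_le_mul_of_nonneg_right
      (mul_le_mul_of_nonneg_right (le_max_left C 1) hN2pos.le) hZ.le)
  have h2 : c * (N : ℝ) ^ 3 ≤ C' * (N : ℝ) ^ 2 := le_of_mul_le_mul_right h1 hZ
  have h3 : (c * (N : ℝ)) * (N : ℝ) ^ 2 ≤ C' * (N : ℝ) ^ 2 := by
    have e : c * (N : ℝ) ^ 3 = (c * (N : ℝ)) * (N : ℝ) ^ 2 := by ring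
    rwa [e] at h2
  have h4 : c * (N : ℝ) ≤ C' := le_of_mul_le_mul_right h3 hN2pos
  have h5 : C' < c * (N : ℝ) := by
    have := hN3
    rw [div_lt_iff₀ hc] at this
    linarith
  linarith

end Summit.AtomisticToContinuum.FouriersLaw.Theorems.ConeScaleCorrector.Negative.Floors
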